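import Literature.Computability.QuantumComplexity.JonesPost
import Literature.Computability.Complexity.FoldBricks
import Literature.Computability.Complexity.UnaryOffsets
import HarnessLib

/-!
# A polynomial-time post-processor for the AJL family

Topic `Literature/Computability/QuantumComplexity`; a step in the discharge of
`ajl_jonesApproxProblem_mem_PromiseBQP` (and through `PromiseBQPOverTransport.lean` of
`ajl_mem_PromiseBQPOver_ajlGateSet`): the hypothesis "post-processor `∈ FP`" of
`AJLCore.mem_PromiseBQP_of_specs` / `AJLCore.mem_PromiseBQP_of_FP` (`JonesFinalGlue.lean`,
`JonesPost.lean`). Aharonov–Jones–Landau (arXiv:quant-ph/0511096 = Algorithmica 55 (2009), §3.3,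
Algorithm Approximate-Jones-Plat-Closure, last two lines): "let `r` be the average over all
`x_j + i y_j`; output `r`", decided in the tree's threshold form by the exact rule
`AJLSampler.accept` (`JonesSamplerAnalysis.lean`): accept iff `(θ + 1/(2·prec))² ≤ r_R² + r_I²` with
`r_R = 1 - 2 c_R/K`, `r_I = 1 - 2 c_I/K`, `c_R`, `c_I` the counts of ones among the `K` test qubits of
either type. This is classical polynomial-time arithmetic on the measured string; here it is carried
out in the tree's `FP` string algebra (`BrickAlgebra.lean`, `StackBricks*.lean`, `FoldBricks.lean`,
`UnaryOffsets.lean`, `PlumbingBricks.lean`, `HashBricks.lean`):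

* `ajlPostF` — on `⟨a, y⟩` with `a = ⟨bin n, ⟨word, ⟨bin θn, ⟨bin θd, 1^prec⟩⟩⟩⟩` an instance record:
  the size parameter `t = max (2·#letters + 2) prec` in unary (`sizeUF`), the unary yardsticks of
  lengths `t²`, `ℓ = 16 t²` (the digest length) and `K = 192 t²` (`mulLenFn`), the two windows
  `y[ℓ, ℓ + K)` and `y[ℓ + K, ℓ + 2K)` of test qubits (`dropFn`, `takeFn`) and their pop-counts
  `c_R`, `c_I` (`popCountFn`), and the integer comparison
  `K²·(2·prec·θn + θd)² ≤ (2·prec·θd)²·(|K - 2c_R|² + |K - 2c_I|²)` (`prodFn`, `addFn`, `subFn`, `ltFn`),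
  which is `accept` (`JonesPost.accept_iff_int`); `ajlPostF ∈ FP` by construction (`ajlPostF_mem_FP`);
* `cnt_eq_count_take_drop` — the counts `AJLCore.cnt` of `JonesFinalGlue.lean` are the pop-counts of
  the windows;
* **`postSpec_ajlPostF : PostSpec digest ajlPostF`**, and the assembly
  **`mem_PromiseBQP_of_uniform_of_digest`**: `family.IsUniform → digest ∈ FP →
  ajl_jonesApproxProblem_mem_PromiseBQP` — of the three hypotheses of `mem_PromiseBQP_of_FP` the
  post-processor is discharged;
* `PostSpec.congr_digest`, `DigestSpec.congr` — the specifications only see the digest on encodings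
  of valid instances, so any `FP` function agreeing with `digest` there may replace it (for the
  digest step, whose literal `digest` decodes arbitrary strings).

We do not prove `post ∈ FP` for the closed form `post` of `JonesPost.lean` itself: that function
reads its numerals with Mathlib's `Computability.decodeNat`, which disagrees with the bricks'
`bitsToNat` on non-canonical strings (`decodeNat [false] = 2`); the specification route makes the
behaviour off the encodings irrelevant.

## References

* D. Aharonov, V. Jones, Z. Landau, *A polynomial quantum algorithm for approximating the Jones
  polynomial*, Algorithmica 55 (2009) 395–421 = arXiv:quant-ph/0511096, §3.3 (Algorithm
  Approximate-Jones-Plat-Closure), Claim 3.3, Thm. 1.2 [AharonovJonesLandau2009].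
* S. Arora, B. Barak, *Computational Complexity: A Modern Approach*, CUP 2009, §1.3 (polynomial
  time is closed under composition; schoolbook arithmetic) [AroraBarak2009].
-/

noncomputable section

namespace Literature.Computability.QuantumComplexity

open _root_.Computability Cryptography Complexity Complexity.Brick AJLSampler

namespace AJLCore

/-! ### Counts of test qubits are pop-counts of windows -/

/-- The pop-count of a prefix `y ↾ K` is the number of indices `i < K` with `y.getD i false = true`
(bits past the end of `y` read `0`). [folklore] -/
theorem count_take (y : List Bool) :
    ∀ K : ℕ, (y.take K).count true = ((Finset.univ : Finset (Fin K)).filter fun i : Fin K => y.getD (i : ℕ) false = true).card := by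
  induction y with
  | nil => intro K; simp
  | cons a y ih =>
    intro K
    cases K with
    | zero => simp
    | succ K =>
      rw [List.take_succ_cons, List.count_cons, ih K, Fin.card_filter_univ_succ']
      simp [add_comm]

/-- The pop-count of the window `y[s, s + K)` (bits past the end of `y` not counted) is the number of
indices `i < K` with `y.getD (s + i) false = true`. [folklore] -/
theorem count_take_drop (y : List Bool) (s K : ℕ) :
    ((y.drop s).take K).count true =
      ((Finset.univ : Finset (Fin K)).filter fun i : Fin K => y.getD (s + (i : ℕ)) false = true).card := by
  rw [count_take]
  congr 1
  ext i
  simp [List.getD_eq_getElem?_getD]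

/-- **The counts `cnt` are pop-counts of windows of the measured string**: type `0` reads
`y[ℓ, ℓ + K)`, type `1` reads `y[ℓ + K, ℓ + 2K)`. [cite: AharonovJonesLandau2009, §3.3] -/
theorem cnt_eq_count_take_drop (ℓ : ℕ) (y : List Bool) (ty : Bool) :
    cnt ℓ y ty = ((y.drop (ℓ + if ty then KOf ℓ else 0)).take (KOf ℓ)).count true := by
  rw [count_take_drop, cnt]
  simp only [Nat.add_assoc]

/-! ### The specifications only see valid encodings -/

/-- A digest function agreeing with a specified one on the encodings of valid instances meets the
specification. [folklore] -/
theorem DigestSpec.congr {h h' : List Bool → List Bool} (hh : DigestSpec h)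
    (he : ∀ x : RawJonesInstance, x.IsValid → h' (RawJonesInstance.encoding.encode x) = h (RawJonesInstance.encoding.encode x)) :
    DigestSpec h' := by
  refine ⟨fun x hx => ?_⟩
  rw [he x hx]
  exact hh.spec x hx

/-- The post-processor specification depends on the digest only through its values on encodings of
valid instances. [folklore] -/
theorem PostSpec.congr_digest {h h' g : List Bool → List Bool} (hg : PostSpec h g)
    (he : ∀ x : RawJonesInstance, x.IsValid → h' (RawJonesInstance.encoding.encode x) = h (RawJonesInstance.encoding.encode x)) :
    PostSpec h' g := by
  refine ⟨fun x hx y => ?_⟩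
  rw [he x hx]
  exact hg.spec x hx y

/-! ### String-function combinators -/

/-- Product of two computed numerals: `z ↦ bin (⟦f z⟧ · ⟦g z⟧)`. [folklore] -/
def mulSF (f g : List Bool → List Bool) : List Bool → List Bool := prodFn ∘ fanoutFn f g

/-- Sum of two computed numerals. [folklore] -/
def addSF (f g : List Bool → List Bool) : List Bool → List Bool := addFn ∘ fanoutFn f g

/-- Truncated difference of two computed numerals. [folklore] -/
def subSF (f g : List Bool → List Bool) : List Bool → List Bool := subFn ∘ fanoutFn f g

/-- `mulSF f g ∈ FP`. [cite: AroraBarak2009, §1.3] -/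
theorem mulSF_mem_FP {f g : List Bool → List Bool} (hf : f ∈ FP) (hg : g ∈ FP) : mulSF f g ∈ FP :=
  comp_mem_FP prodFn_mem_FP (fanoutFn_mem_FP hf hg)

/-- `addSF f g ∈ FP`. [cite: AroraBarak2009, §1.3] -/
theorem addSF_mem_FP {f g : List Bool → List Bool} (hf : f ∈ FP) (hg : g ∈ FP) : addSF f g ∈ FP :=
  comp_mem_FP addFn_mem_FP (fanoutFn_mem_FP hf hg)

/-- `subSF f g ∈ FP`. [cite: AroraBarak2009, §1.3] -/
theorem subSF_mem_FP {f g : List Bool → List Bool} (hf : f ∈ FP) (hg : g ∈ FP) : subSF f g ∈ FP :=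
  comp_mem_FP subFn_mem_FP (fanoutFn_mem_FP hf hg)

/-- Value of `mulSF`. [folklore] -/
@[simp] theorem mulSF_apply (f g : List Bool → List Bool) (z : List Bool) :
    mulSF f g z = encodeNat (bitsToNat (f z) * bitsToNat (g z)) := by
  simp [mulSF]

/-- Value of `addSF`. [folklore] -/
@[simp] theorem addSF_apply (f g : List Bool → List Bool) (z : List Bool) :
    addSF f g z = encodeNat (bitsToNat (f z) + bitsToNat (g z)) := by
  simp [addSF]

/-- Value of `subSF`. [folklore] -/
@[simp] theorem subSF_apply (f g : List Bool → List Bool) (z : List Bool) :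
    subSF f g z = encodeNat (bitsToNat (f z) - bitsToNat (g z)) := by
  simp [subSF]

/-! ### The fields of the instance record -/

/-- The unary letter count `1^m` (header of the word field). [folklore] -/
def lettersUF : List Bool → List Bool := fstF ∘ nthF 1 ∘ fstF

/-- The unary precision `1^prec` (last field). [folklore] -/
def precUF : List Bool → List Bool := sndPow 3 ∘ fstF

/-- The numerator `bin θn`. [folklore] -/
def thetaNumF : List Bool → List Bool := nthF 2 ∘ fstF

/-- The denominator `bin θd`. [folklore] -/
def thetaDenF : List Bool → List Bool := nthF 3 ∘ fstF

/-- `lettersUF ∈ FP`. [folklore] -/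
theorem lettersUF_mem_FP : lettersUF ∈ FP := comp_mem_FP fstF_mem_FP (comp_mem_FP (nthF_mem_FP 1) fstF_mem_FP)

/-- `precUF ∈ FP`. [folklore] -/
theorem precUF_mem_FP : precUF ∈ FP := comp_mem_FP (sndPow_mem_FP 3) fstF_mem_FP

/-- `thetaNumF ∈ FP`. [folklore] -/
theorem thetaNumF_mem_FP : thetaNumF ∈ FP := comp_mem_FP (nthF_mem_FP 2) fstF_mem_FP

/-- `thetaDenF ∈ FP`. [folklore] -/
theorem thetaDenF_mem_FP : thetaDenF ∈ FP := comp_mem_FP (nthF_mem_FP 3) fstF_mem_FP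

/-! ### Unary yardsticks: `t`, `t²`, `ℓ = 16 t²`, `K = 192 t²` -/

/-- A string of length `2m + 2`. [folklore] -/
def strandsUF : List Bool → List Bool := fun z => lettersUF z ++ (lettersUF z ++ [true, true])

/-- **The size parameter in unary**: the longer of `1^{2m+2}` and `1^prec`, of length
`t = max (2m + 2) prec`. [cite: AharonovJonesLandau2009, §3.3] -/
def sizeUF : List Bool → List Bool := iteFn (ltLenF ∘ fanoutFn strandsUF precUF) precUF strandsUF

/-- A string of length `t²`. [folklore] -/
def sizeSqUF : List Bool → List Bool := UnaryOffsets.mulLenFn ∘ fanoutFn sizeUF sizeUF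

/-- A string of length `ℓ = 16 t²` (the length of the digest). [folklore] -/
def digestLenUF : List Bool → List Bool := UnaryOffsets.mulLenFn ∘ fanoutFn (fun _ => List.replicate 16 true) sizeSqUF

/-- A string of length `K = 192 t²` (the number of trials of each type). [folklore] -/
def trialsUF : List Bool → List Bool := UnaryOffsets.mulLenFn ∘ fanoutFn (fun _ => List.replicate 192 true) sizeSqUF

/-- `strandsUF ∈ FP`. [folklore] -/
theorem strandsUF_mem_FP : strandsUF ∈ FP := append_mem_FP lettersUF_mem_FP (append_mem_FP lettersUF_mem_FP (const_mem_FP _))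

/-- `sizeUF ∈ FP`. [folklore] -/
theorem sizeUF_mem_FP : sizeUF ∈ FP :=
  iteFn_mem_FP (comp_mem_FP ltLenF_mem_FP (fanoutFn_mem_FP strandsUF_mem_FP precUF_mem_FP)) precUF_mem_FP strandsUF_mem_FP

/-- `sizeSqUF ∈ FP`. [folklore] -/
theorem sizeSqUF_mem_FP : sizeSqUF ∈ FP := comp_mem_FP UnaryOffsets.mulLenFn_mem_FP (fanoutFn_mem_FP sizeUF_mem_FP sizeUF_mem_FP)

/-- `digestLenUF ∈ FP`. [folklore] -/
theorem digestLenUF_mem_FP : digestLenUF ∈ FP := comp_mem_FP UnaryOffsets.mulLenFn_mem_FP (fanoutFn_mem_FP (const_mem_FP _) sizeSqUF_mem_FP)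

/-- `trialsUF ∈ FP`. [folklore] -/
theorem trialsUF_mem_FP : trialsUF ∈ FP := comp_mem_FP UnaryOffsets.mulLenFn_mem_FP (fanoutFn_mem_FP (const_mem_FP _) sizeSqUF_mem_FP)

/-- `|sizeUF z| = max (2|lettersUF z| + 2) |precUF z|`. [folklore] -/
theorem length_sizeUF (z : List Bool) : (sizeUF z).length = max (2 * (lettersUF z).length + 2) (precUF z).length := by
  have hc : (ltLenF ∘ fanoutFn strandsUF precUF) z = [decide ((strandsUF z).length < (precUF z).length)] := by
    simp only [Function.comp_apply, fanoutFn_apply, ltLenF_boolPair]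
  have h1 : (strandsUF z).length = 2 * (lettersUF z).length + 2 := by
    simp only [strandsUF, List.length_append, List.length_cons, List.length_nil]; omega
  rw [sizeUF, iteFn_apply hc]
  by_cases hlt : (strandsUF z).length < (precUF z).length
  · rw [decide_eq_true hlt, if_pos rfl]; omega
  · rw [decide_eq_false hlt]; simp only [Bool.false_eq_true, ↓reduceIte]; omega

/-- `|sizeSqUF z| = |sizeUF z|²`. [folklore] -/
theorem length_sizeSqUF (z : List Bool) : (sizeSqUF z).length = (sizeUF z).length ^ 2 := by
  simp only [sizeSqUF, Function.comp_apply, fanoutFn_apply, UnaryOffsets.length_mulLenFn, pow_two]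

/-- `|digestLenUF z| = 16 |sizeUF z|²`. [folklore] -/
theorem length_digestLenUF (z : List Bool) : (digestLenUF z).length = 16 * (sizeUF z).length ^ 2 := by
  simp only [digestLenUF, Function.comp_apply, fanoutFn_apply, UnaryOffsets.length_mulLenFn, List.length_replicate, length_sizeSqUF]

/-- `|trialsUF z| = 192 |sizeUF z|²`. [folklore] -/
theorem length_trialsUF (z : List Bool) : (trialsUF z).length = 192 * (sizeUF z).length ^ 2 := by
  simp only [trialsUF, Function.comp_apply, fanoutFn_apply, UnaryOffsets.length_mulLenFn, List.length_replicate, length_sizeSqUF]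

/-! ### Windows of test qubits and their counts -/

/-- The measured string past the digest: `y ⇂ ℓ`. [folklore] -/
def pastDigestF : List Bool → List Bool := Plumb.dropFn ∘ fanoutFn digestLenUF sndF

/-- The window of the real-part test qubits: `y[ℓ, ℓ + K)`. [cite: AharonovJonesLandau2009, §3.3] -/
def realWindowF : List Bool → List Bool := Plumb.takeFn ∘ fanoutFn trialsUF pastDigestF

/-- The window of the imaginary-part test qubits: `y[ℓ + K, ℓ + 2K)`. [cite: AharonovJonesLandau2009, §3.3] -/
def imagWindowF : List Bool → List Bool := Plumb.takeFn ∘ fanoutFn trialsUF (Plumb.dropFn ∘ fanoutFn trialsUF pastDigestF)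

/-- The count `bin c_R`. [cite: AharonovJonesLandau2009, §3.3] -/
def realCountF : List Bool → List Bool := HashBricks.popCountFn ∘ realWindowF

/-- The count `bin c_I`. [cite: AharonovJonesLandau2009, §3.3] -/
def imagCountF : List Bool → List Bool := HashBricks.popCountFn ∘ imagWindowF

/-- `bin K`. [folklore] -/
def trialsBinF : List Bool → List Bool := lenBinF ∘ trialsUF

/-- `bin prec`. [folklore] -/
def precBinF : List Bool → List Bool := lenBinF ∘ precUF

/-- `pastDigestF ∈ FP`. [folklore] -/
theorem pastDigestF_mem_FP : pastDigestF ∈ FP := comp_mem_FP Plumb.dropFn_mem_FP (fanoutFn_mem_FP digestLenUF_mem_FP sndF_mem_FP)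

/-- `realWindowF ∈ FP`. [folklore] -/
theorem realWindowF_mem_FP : realWindowF ∈ FP := comp_mem_FP Plumb.takeFn_mem_FP (fanoutFn_mem_FP trialsUF_mem_FP pastDigestF_mem_FP)

/-- `imagWindowF ∈ FP`. [folklore] -/
theorem imagWindowF_mem_FP : imagWindowF ∈ FP :=
  comp_mem_FP Plumb.takeFn_mem_FP (fanoutFn_mem_FP trialsUF_mem_FP (comp_mem_FP Plumb.dropFn_mem_FP (fanoutFn_mem_FP trialsUF_mem_FP pastDigestF_mem_FP)))

/-- `realCountF ∈ FP`. [folklore] -/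
theorem realCountF_mem_FP : realCountF ∈ FP := comp_mem_FP HashBricks.popCountFn_mem_FP realWindowF_mem_FP

/-- `imagCountF ∈ FP`. [folklore] -/
theorem imagCountF_mem_FP : imagCountF ∈ FP := comp_mem_FP HashBricks.popCountFn_mem_FP imagWindowF_mem_FP

/-- `trialsBinF ∈ FP`. [folklore] -/
theorem trialsBinF_mem_FP : trialsBinF ∈ FP := comp_mem_FP lenBinF_mem_FP trialsUF_mem_FP

/-- `precBinF ∈ FP`. [folklore] -/
theorem precBinF_mem_FP : precBinF ∈ FP := comp_mem_FP lenBinF_mem_FP precUF_mem_FP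

/-- Value of `realWindowF`: the window `y[ℓ, ℓ + K)` of the second component. [folklore] -/
theorem realWindowF_apply (z : List Bool) : realWindowF z = ((sndF z).drop (digestLenUF z).length).take (trialsUF z).length := by
  simp only [realWindowF, pastDigestF, Function.comp_apply, fanoutFn_apply, Plumb.takeFn_boolPair, Plumb.dropFn_boolPair]

/-- Value of `imagWindowF`: the window `y[ℓ + K, ℓ + 2K)` of the second component. [folklore] -/
theorem imagWindowF_apply (z : List Bool) : imagWindowF z = ((sndF z).drop ((digestLenUF z).length + (trialsUF z).length)).take (trialsUF z).length := by
  simp only [imagWindowF, pastDigestF, Function.comp_apply, fanoutFn_apply, Plumb.takeFn_boolPair, Plumb.dropFn_boolPair, List.drop_drop]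

/-! ### The decision -/

/-- `bin 2`. [folklore] -/
def binTwoF : List Bool → List Bool := fun _ => encodeNat 2

/-- `bin (2·prec·θn + θd)`. [folklore] -/
def lhsRootF : List Bool → List Bool := addSF (mulSF (mulSF binTwoF precBinF) thetaNumF) thetaDenF

/-- `bin (2·prec·θd)`. [folklore] -/
def rhsScaleF : List Bool → List Bool := mulSF (mulSF binTwoF precBinF) thetaDenF

/-- The left-hand side `bin (K²·(2·prec·θn + θd)²)`. [cite: AharonovJonesLandau2009, §3.3] -/
def ajlLhsF : List Bool → List Bool := mulSF (mulSF trialsBinF trialsBinF) (mulSF lhsRootF lhsRootF)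

/-- `bin |K - 2c|` for a computed count `c` (sum of the two truncated differences). [folklore] -/
def absDiffF (c : List Bool → List Bool) : List Bool → List Bool :=
  addSF (subSF trialsBinF (mulSF binTwoF c)) (subSF (mulSF binTwoF c) trialsBinF)

/-- The right-hand side `bin ((2·prec·θd)²·(|K - 2c_R|² + |K - 2c_I|²))`. [cite: AharonovJonesLandau2009, §3.3] -/
def ajlRhsF : List Bool → List Bool := mulSF (mulSF rhsScaleF rhsScaleF) (addSF (mulSF (absDiffF realCountF) (absDiffF realCountF)) (mulSF (absDiffF imagCountF) (absDiffF imagCountF)))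

/-- **The post-processor**: the bit `[LHS ≤ RHS]`. [cite: AharonovJonesLandau2009, §3.3 and Claim 3.3] -/
def ajlPostF : List Bool → List Bool := notFn (ltFn ∘ fanoutFn ajlRhsF ajlLhsF)

/-- `binTwoF ∈ FP`. [folklore] -/
theorem binTwoF_mem_FP : binTwoF ∈ FP := const_mem_FP _

/-- `lhsRootF ∈ FP`. [folklore] -/
theorem lhsRootF_mem_FP : lhsRootF ∈ FP :=
  addSF_mem_FP (mulSF_mem_FP (mulSF_mem_FP binTwoF_mem_FP precBinF_mem_FP) thetaNumF_mem_FP) thetaDenF_mem_FP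

/-- `rhsScaleF ∈ FP`. [folklore] -/
theorem rhsScaleF_mem_FP : rhsScaleF ∈ FP := mulSF_mem_FP (mulSF_mem_FP binTwoF_mem_FP precBinF_mem_FP) thetaDenF_mem_FP

/-- `ajlLhsF ∈ FP`. [folklore] -/
theorem ajlLhsF_mem_FP : ajlLhsF ∈ FP :=
  mulSF_mem_FP (mulSF_mem_FP trialsBinF_mem_FP trialsBinF_mem_FP) (mulSF_mem_FP lhsRootF_mem_FP lhsRootF_mem_FP)

/-- `absDiffF c ∈ FP`. [folklore] -/
theorem absDiffF_mem_FP {c : List Bool → List Bool} (hc : c ∈ FP) : absDiffF c ∈ FP :=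
  addSF_mem_FP (subSF_mem_FP trialsBinF_mem_FP (mulSF_mem_FP binTwoF_mem_FP hc)) (subSF_mem_FP (mulSF_mem_FP binTwoF_mem_FP hc) trialsBinF_mem_FP)

/-- `ajlRhsF ∈ FP`. [folklore] -/
theorem ajlRhsF_mem_FP : ajlRhsF ∈ FP :=
  mulSF_mem_FP (mulSF_mem_FP rhsScaleF_mem_FP rhsScaleF_mem_FP)
    (addSF_mem_FP (mulSF_mem_FP (absDiffF_mem_FP realCountF_mem_FP) (absDiffF_mem_FP realCountF_mem_FP))
      (mulSF_mem_FP (absDiffF_mem_FP imagCountF_mem_FP) (absDiffF_mem_FP imagCountF_mem_FP)))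

/-- **The post-processor is polynomial-time.** [cite: AharonovJonesLandau2009, Thm. 1.2 ("classical polynomial post-processing")] [cite: AroraBarak2009, §1.3] -/
theorem ajlPostF_mem_FP : ajlPostF ∈ FP := notFn_mem_FP (comp_mem_FP ltFn_mem_FP (fanoutFn_mem_FP ajlRhsF_mem_FP ajlLhsF_mem_FP))

/-- Value of `absDiffF`: `|K - 2c|` as a natural number. [folklore] -/
theorem bitsToNat_absDiffF (c : List Bool → List Bool) (z : List Bool) :
    bitsToNat (absDiffF c z) = (bitsToNat (trialsBinF z) - 2 * bitsToNat (c z)) + (2 * bitsToNat (c z) - bitsToNat (trialsBinF z)) := by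
  simp [absDiffF, binTwoF]

/-- **Value of the post-processor on any string**: the comparison bit of the two sides, in terms of
the numerals `K = |trialsUF z|`, `prec = |precUF z|`, `θn = ⟦thetaNumF z⟧`, `θd = ⟦thetaDenF z⟧` and the pop-counts of the
two windows. [folklore] -/
theorem ajlPostF_apply (z : List Bool) :
    ajlPostF z = [!decide (
      (2 * (precUF z).length * bitsToNat (thetaDenF z)) * (2 * (precUF z).length * bitsToNat (thetaDenF z)) *
        (((trialsUF z).length - 2 * (realWindowF z).count true + (2 * (realWindowF z).count true - (trialsUF z).length)) *
            ((trialsUF z).length - 2 * (realWindowF z).count true + (2 * (realWindowF z).count true - (trialsUF z).length)) +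
          ((trialsUF z).length - 2 * (imagWindowF z).count true + (2 * (imagWindowF z).count true - (trialsUF z).length)) *
            ((trialsUF z).length - 2 * (imagWindowF z).count true + (2 * (imagWindowF z).count true - (trialsUF z).length))) <
      (trialsUF z).length * (trialsUF z).length *
        ((2 * (precUF z).length * bitsToNat (thetaNumF z) + bitsToNat (thetaDenF z)) *
          (2 * (precUF z).length * bitsToNat (thetaNumF z) + bitsToNat (thetaDenF z))))] := by
  have hc : (ltFn ∘ fanoutFn ajlRhsF ajlLhsF) z = [decide (bitsToNat (ajlRhsF z) < bitsToNat (ajlLhsF z))] := by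
    simp only [Function.comp_apply, fanoutFn_apply, ltFn_boolPair]
  rw [ajlPostF, notFn_apply hc]
  simp [ajlRhsF, ajlLhsF, lhsRootF, rhsScaleF, bitsToNat_absDiffF, trialsBinF, precBinF, realCountF, imagCountF, binTwoF]

/-! ### On encodings of valid instances -/

section Encodings

variable (x : RawJonesInstance) (y : List Bool)

/-- The fields read off `⟨encode x, y⟩`. [folklore] -/
theorem fields_apply :
    lettersUF (boolPair (RawJonesInstance.encoding.encode x) y) = unaryEncodeNat x.2.1.length ∧
    precUF (boolPair (RawJonesInstance.encoding.encode x) y) = unaryEncodeNat x.prec ∧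
    thetaNumF (boolPair (RawJonesInstance.encoding.encode x) y) = encodeNat x.2.2.1 ∧
    thetaDenF (boolPair (RawJonesInstance.encoding.encode x) y) = encodeNat x.2.2.2.1 ∧
    sndF (boolPair (RawJonesInstance.encoding.encode x) y) = y := by
  obtain ⟨n, wd, θn, θd, prec⟩ := x
  simp [lettersUF, precUF, thetaNumF, thetaDenF, RawJonesInstance.encoding, Encoding.pairBool, Encoding.listBool, RawJonesInstance.prec,
    encodingNatBool, unaryEncodingNat, nthF_succ_boolPair, nthF_zero_boolPair, sndPow_succ_boolPair, sndPow_zero_boolPair]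

/-- `|sizeUF| = tI x` on `⟨encode x, y⟩`. [folklore] -/
theorem length_sizeUF_encode : (sizeUF (boolPair (RawJonesInstance.encoding.encode x) y)).length = tI x := by
  obtain ⟨h1, h2, -, -, -⟩ := fields_apply x y
  rw [length_sizeUF, h1, h2, tI]
  have e1 : (unaryEncodeNat x.2.1.length).length = x.2.1.length := unary_decode_encode_nat _
  have e2 : (unaryEncodeNat x.prec).length = x.prec := unary_decode_encode_nat _
  rw [e1, e2]; omega

/-- `|digestLenUF|` is the length of the digest on `⟨encode x, y⟩`. [folklore] -/
theorem length_digestLenUF_encode :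
    (digestLenUF (boolPair (RawJonesInstance.encoding.encode x) y)).length = (digest (RawJonesInstance.encoding.encode x)).length := by
  rw [length_digestLenUF, length_sizeUF_encode, digest_encode, length_digestRaw]

/-- `|trialsUF| = K` on `⟨encode x, y⟩`. [folklore] -/
theorem length_trialsUF_encode :
    (trialsUF (boolPair (RawJonesInstance.encoding.encode x) y)).length = KOf (digest (RawJonesInstance.encoding.encode x)).length := by
  rw [length_trialsUF, length_sizeUF_encode, KOf, digest_encode, tOf_length_digestRaw]

/-- The pop-counts of the windows are the counts `cnt` on `⟨encode x, y⟩`. [cite: AharonovJonesLandau2009, §3.3] -/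
theorem count_windows_encode :
    (realWindowF (boolPair (RawJonesInstance.encoding.encode x) y)).count true = cnt (digest (RawJonesInstance.encoding.encode x)).length y false ∧
    (imagWindowF (boolPair (RawJonesInstance.encoding.encode x) y)).count true = cnt (digest (RawJonesInstance.encoding.encode x)).length y true := by
  obtain ⟨-, -, -, -, h5⟩ := fields_apply x y
  rw [realWindowF_apply, imagWindowF_apply, h5, length_digestLenUF_encode, length_trialsUF_encode, cnt_eq_count_take_drop, cnt_eq_count_take_drop]
  simp

end Encodings

/-- The integer square of `|K - c|` computed with truncated subtractions. [folklore] -/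
theorem cast_absDiff_sq (K c : ℕ) : (((K - c + (c - K) : ℕ) : ℤ)) ^ 2 = ((K : ℤ) - c) ^ 2 := by
  rcases le_total K c with h | h
  · rw [Nat.sub_eq_zero_of_le h, zero_add, Nat.cast_sub h]; ring
  · rw [Nat.sub_eq_zero_of_le h, add_zero, Nat.cast_sub h]

/-- **The comparison bit is the sampler's decision** (`JonesPost.accept_iff_int`, read over `ℕ` with
`|K - 2c|` in place of the integer difference). [cite: AharonovJonesLandau2009, §3.3 and Claim 3.3] -/
theorem not_decide_lt_eq_accept {θn θd prec K cR cI : ℕ} (hθd : 0 < θd) (hprec : 0 < prec) (hK : 0 < K) :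
    (!decide (
      (2 * prec * θd) * (2 * prec * θd) *
        ((K - 2 * cR + (2 * cR - K)) * (K - 2 * cR + (2 * cR - K)) +
          (K - 2 * cI + (2 * cI - K)) * (K - 2 * cI + (2 * cI - K))) <
      K * K * ((2 * prec * θn + θd) * (2 * prec * θn + θd)))) = accept θn θd prec K cR cI := by
  rw [Bool.eq_iff_iff, accept_iff_int hθd hprec hK]
  simp only [Bool.not_eq_true', decide_eq_false_iff_not, not_lt]
  generalize hdR : K - 2 * cR + (2 * cR - K) = dR
  generalize hdI : K - 2 * cI + (2 * cI - K) = dI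
  have hR : (dR : ℤ) ^ 2 = ((K : ℤ) - (2 * cR : ℕ)) ^ 2 := by rw [← hdR]; exact cast_absDiff_sq K (2 * cR)
  have hI : (dI : ℤ) ^ 2 = ((K : ℤ) - (2 * cI : ℕ)) ^ 2 := by rw [← hdI]; exact cast_absDiff_sq K (2 * cI)
  push_cast at hR hI
  have key : (2 * (prec : ℤ) * θd) * (2 * prec * θd) * ((dR : ℤ) * dR + (dI : ℤ) * dI) =
      (2 * prec * θd : ℤ) ^ 2 * (((K : ℤ) - 2 * cR) ^ 2 + ((K : ℤ) - 2 * cI) ^ 2) := by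
    rw [← hR, ← hI]; ring
  have key2 : (K : ℤ) * K * ((2 * (prec : ℤ) * θn + θd) * (2 * prec * θn + θd)) =
      (K : ℤ) ^ 2 * (2 * prec * θn + θd) ^ 2 := by ring
  rw [← Nat.cast_le (α := ℤ)]
  push_cast
  constructor <;> intro h <;> linarith [key, key2, h]

/-- **The post-processor meets the specification**: on `⟨encode x, y⟩`, `x` valid, it outputs the
sampler's decision bit `accept θn θd prec K c_R c_I`. [cite: AharonovJonesLandau2009, §3.3 and Claim 3.3] -/
theorem postSpec_ajlPostF : PostSpec digest ajlPostF := by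
  refine ⟨fun x hx y => ?_⟩
  obtain ⟨-, h2, h3, h4, -⟩ := fields_apply x y
  obtain ⟨c0, c1⟩ := count_windows_encode x y
  have e2 : (unaryEncodeNat x.prec).length = x.prec := unary_decode_encode_nat _
  have hKpos : 0 < KOf (digest (RawJonesInstance.encoding.encode x)).length := by
    rw [KOf, digest_encode, tOf_length_digestRaw]
    exact Nat.mul_pos (by norm_num) (pow_pos (one_le_tI x) 2)
  have hprec : 0 < x.prec := hx.2.2.2.2
  rw [ajlPostF_apply, h2, h3, h4, c0, c1, length_trialsUF_encode, bitsToNat_encodeNat, bitsToNat_encodeNat, e2,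
    not_decide_lt_eq_accept hx.2.2.2.1 hprec hKpos]

/-- **The AJL problem is in `PromiseBQP` given uniformity of the core family and a polynomial-time
digest**: the post-processing hypothesis of `mem_PromiseBQP_of_FP` is discharged by `ajlPostF`.
[cite: AharonovJonesLandau2009, Thm. 1.2] -/
theorem mem_PromiseBQP_of_uniform_of_digest (hU : family.IsUniform) (hd : digest ∈ FP) : ajl_jonesApproxProblem_mem_PromiseBQP :=
  mem_PromiseBQP_of_specs hU hd ajlPostF_mem_FP digestSpec_digest postSpec_ajlPostF

/-- The same with any polynomial-time digest function agreeing with `digest` on the encodings of valid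
instances. [cite: AharonovJonesLandau2009, Thm. 1.2] -/
theorem mem_PromiseBQP_of_uniform_of_digest' (hU : family.IsUniform) {h : List Bool → List Bool} (hh : h ∈ FP)
    (he : ∀ x : RawJonesInstance, x.IsValid → h (RawJonesInstance.encoding.encode x) = digest (RawJonesInstance.encoding.encode x)) :
    ajl_jonesApproxProblem_mem_PromiseBQP :=
  mem_PromiseBQP_of_specs hU hh ajlPostF_mem_FP (digestSpec_digest.congr he) (postSpec_ajlPostF.congr_digest he)

end AJLCore

end Literature.Computability.QuantumComplexity

end
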